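import Summits.ValiantsHypothesis.ValiantsHypothesis.Theorems.BarrierLeverPartitionMinorsYOnlyFactor

/-!
# Route BarrierLever — Chow witnesses for partition minors (items 20172 / 20195): INTEGER CERTIFICATES
# (the partition coefficients of a product of integer affine forms as a recursion, and a `mod p`
# nonsingularity certificate)

Helper file (`--supports stmt-ValiantsHypothesis-20172`; cell valiant-natproofs, rung V4, 𝒟-side of
door (c); seat val-np-p4 gen 11).  Closes NO item.  Conventions of items 19717 / 20172 / 20195: in
`MvPolynomial (Fin (h+h)) R`, `x_a = X (castAdd h a)`, `y_c = X (natAdd h c)`; the layout `(u, w)`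
(`u w : Fin r → Finset (Fin h)`) is HIT when some product of `h + h` affine forms `ℓ q` has
`det [coeff (E (u i) (w j)) (∏ q, ℓ q)]_{i j} ≠ 0`, `E u w = Σ_{a∈u} single (castAdd h a) 1 + Σ_{c∈w}
single (natAdd h c) 1`.

This file turns «exhibit an explicit Chow witness» into a finite check the kernel can run:

* `chowDP c₀ α β m u w : ℤ` — the partition coefficient at `(u, w)` of the product of the first `m`
  INTEGER affine forms `ℓ_k = c₀ k + Σ_a α k a · x_a + Σ_c β k c · y_c`, computed by the recursion of
  `coeff_partitionExpo_mul_affine` (one affine factor = diagonal + `x`-up + `y`-up operators);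
* `coeff_partitionExpo_prod_intForm` — **the recursion IS the coefficient**: over any commutative ring,
  `coeff (E u w) (∏_{k<m} ℓ_k) = chowDP c₀ α β m u w` (cast);
* `chow_hit_of_modCert` — **a `mod p` certificate gives a hit**: if the integer partition matrix
  `M = [chowDP … (h+h) (u i) (w j)]` has a right inverse `B` modulo some `p > 1` (`M·B = 1` over
  `ZMod p`, a `decide`-able identity), then `det M ≠ 0`, so the integer forms hit `(u, w)` over `ℂ`;
* `chow_hit_relabel` — hits are transported along coordinate relabellings `x_a ↦ x_{π a}`,
  `y_c ↦ y_{ρ c}` (any `π ρ : Equiv.Perm (Fin h)`), the companion of `chow_hit_of_perm` (row/column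
  re-indexing) and `chow_hit_swap` (`x ↔ y`).

Used by the height-`3` slice of CPM (the `224` locked layouts there, `24` up to these symmetries,
are certified this way).

WHAT THIS IS NOT: bookkeeping for finite height slices of item 20172; nothing on items 20172 / 20195
/ 19717 themselves (all large `h`), on crux stmt-ValiantsHypothesis-14610, or on `VP` versus `VNP`.
-/

set_option linter.dupNamespace false

namespace Summit.ValiantsHypothesis.ValiantsHypothesis.Theorems.BarrierLever.ChowFactor

open Finset MvPolynomial
open Summit.ValiantsHypothesis.ValiantsHypothesis.Theorems.BarrierLever.CorankRepair (partitionExpo_eq_iff)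

variable {h : ℕ}

/-! ## 1. The recursion -/

/-- **Partition coefficients of a product of integer affine forms, by recursion on the number of
forms.**  `chowDP c₀ α β m u w` is the coefficient of `x^u y^w` in `∏_{k<m} (c₀ k + Σ_a α k a·x_a +
Σ_c β k c·y_c)`: appending the form `k = m` acts by `c₀ m` on the diagonal plus the `x`-up and `y`-up
operators (`coeff_partitionExpo_prod_intForm`). -/
def chowDP (c₀ : ℕ → ℤ) (α β : ℕ → Fin h → ℤ) : ℕ → Finset (Fin h) → Finset (Fin h) → ℤ
  | 0, u, w => if u = ∅ ∧ w = ∅ then 1 else 0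
  | m + 1, u, w => c₀ m * chowDP c₀ α β m u w +
      (∑ a ∈ u, α m a * chowDP c₀ α β m (u.erase a) w) +
      ∑ c ∈ w, β m c * chowDP c₀ α β m u (w.erase c)

/-- The `k`-th integer affine form `c₀ k + Σ_a α k a · x_a + Σ_c β k c · y_c`, read in a commutative
ring `R`. -/
noncomputable def intForm (R : Type*) [CommRing R] (c₀ : ℕ → ℤ) (α β : ℕ → Fin h → ℤ) (k : ℕ) :
    MvPolynomial (Fin (h + h)) R :=
  C (c₀ k : R) + ∑ a, C (α k a : R) * X (Fin.castAdd h a) + ∑ c, C (β k c : R) * X (Fin.natAdd h c)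

/-- An integer affine form has total degree `≤ 1`. -/
theorem totalDegree_intForm_le (R : Type*) [CommRing R] (c₀ : ℕ → ℤ) (α β : ℕ → Fin h → ℤ) (k : ℕ) :
    (intForm R c₀ α β k).totalDegree ≤ 1 := by
  have hterm : ∀ (r : R) (v : Fin (h + h)), (C r * X v : MvPolynomial (Fin (h + h)) R).totalDegree ≤ 1 :=
    fun r v => by
      refine (totalDegree_mul _ _).trans ?_
      rw [totalDegree_C, zero_add]
      refine (totalDegree_monomial_le _ _).trans ?_
      rw [Finsupp.sum_single_index rfl]
      exact le_rfl
  unfold intForm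
  refine (totalDegree_add _ _).trans (max_le ((totalDegree_add _ _).trans (max_le ?_ ?_)) ?_)
  · rw [totalDegree_C]
    exact Nat.zero_le _
  · exact (totalDegree_finsetSum _ _).trans (Finset.sup_le fun a _ => hterm _ _)
  · exact (totalDegree_finsetSum _ _).trans (Finset.sup_le fun c _ => hterm _ _)

/-- `coeff (E u w) 1 = [u = ∅ ∧ w = ∅]`. -/
theorem coeff_partitionExpo_one (R : Type*) [CommRing R] (u w : Finset (Fin h)) :
    coeff (∑ a ∈ u, Finsupp.single (Fin.castAdd h a) 1 + ∑ c ∈ w, Finsupp.single (Fin.natAdd h c) 1)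
      (1 : MvPolynomial (Fin (h + h)) R) = if u = ∅ ∧ w = ∅ then 1 else 0 := by
  classical
  rw [coeff_one]
  have key : ((0 : Fin (h + h) →₀ ℕ) =
      ∑ a ∈ u, Finsupp.single (Fin.castAdd h a) 1 + ∑ c ∈ w, Finsupp.single (Fin.natAdd h c) 1) ↔
      (u = ∅ ∧ w = ∅) := by
    have e := partitionExpo_eq_iff (h := h) ∅ ∅ u w
    rw [Finset.sum_empty, Finset.sum_empty, add_zero] at e
    rw [e]
    exact ⟨fun ⟨h1, h2⟩ => ⟨h1.symm, h2.symm⟩, fun ⟨h1, h2⟩ => ⟨h1.symm, h2.symm⟩⟩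
  by_cases huw : u = ∅ ∧ w = ∅
  · rw [if_pos (key.mpr huw), if_pos huw]
  · rw [if_neg (fun e => huw (key.mp e)), if_neg huw]

/-- **The recursion is the coefficient**: over any commutative ring, the partition coefficient at
`(u, w)` of the product of the first `m` integer affine forms is `chowDP c₀ α β m u w`. -/
theorem coeff_partitionExpo_prod_intForm (R : Type*) [CommRing R] (c₀ : ℕ → ℤ) (α β : ℕ → Fin h → ℤ)
    (m : ℕ) : ∀ u w : Finset (Fin h),
    coeff (∑ a ∈ u, Finsupp.single (Fin.castAdd h a) 1 + ∑ c ∈ w, Finsupp.single (Fin.natAdd h c) 1)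
      (∏ k ∈ Finset.range m, intForm R c₀ α β k) = (chowDP c₀ α β m u w : R) := by
  classical
  induction m with
  | zero =>
    intro u w
    rw [Finset.prod_range_zero, coeff_partitionExpo_one, chowDP]
    push_cast
    rfl
  | succ m ih =>
    intro u w
    rw [Finset.prod_range_succ, intForm, coeff_partitionExpo_mul_affine, ih, chowDP]
    simp_rw [ih]
    push_cast
    rfl

/-! ## 2. A `mod p` certificate gives a hit -/

/-- **A `mod p` nonsingularity certificate for the integer partition matrix gives a Chow witness.**
If `M = [chowDP c₀ α β (h+h) (u i) (w j)]_{i j}` satisfies `M · B = 1` over `ZMod p` for some `p > 1`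
and some `B`, then the `h + h` integer affine forms hit the layout `(u, w)` over `ℂ`. -/
theorem chow_hit_of_modCert {r : ℕ} (u w : Fin r → Finset (Fin h)) (c₀ : ℕ → ℤ) (α β : ℕ → Fin h → ℤ)
    (p : ℕ) (hp : 1 < p) (B : Matrix (Fin r) (Fin r) (ZMod p))
    (hB : (Matrix.of fun i j : Fin r => ((chowDP c₀ α β (h + h) (u i) (w j) : ℤ) : ZMod p)) * B = 1) :
    ∃ ℓ : Fin (h + h) → MvPolynomial (Fin (h + h)) ℂ, (∀ q, (ℓ q).totalDegree ≤ 1) ∧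
      (Matrix.of fun i j : Fin r => coeff
        (∑ b ∈ u i, Finsupp.single (Fin.castAdd h b) 1 + ∑ d ∈ w j, Finsupp.single (Fin.natAdd h d) 1)
        (∏ q, ℓ q)).det ≠ 0 := by
  classical
  haveI : Fact (1 < p) := ⟨hp⟩
  -- the integer partition matrix and its determinant
  set M : Matrix (Fin r) (Fin r) ℤ := Matrix.of fun i j => chowDP c₀ α β (h + h) (u i) (w j) with hM
  have hdetZ : M.det ≠ 0 := by
    intro h0
    have e : (Int.castRingHom (ZMod p)).mapMatrix M =
        Matrix.of fun i j : Fin r => ((chowDP c₀ α β (h + h) (u i) (w j) : ℤ) : ZMod p) := by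
      ext i j
      rfl
    have h1 : ((Int.castRingHom (ZMod p)).mapMatrix M).det * B.det = 1 := by
      rw [← Matrix.det_mul, e, hB, Matrix.det_one]
    rw [← RingHom.map_det, h0, map_zero, zero_mul] at h1
    exact zero_ne_one h1
  refine ⟨fun q => intForm ℂ c₀ α β (q : ℕ), fun q => totalDegree_intForm_le ℂ c₀ α β (q : ℕ), ?_⟩
  have hprod : (∏ q : Fin (h + h), intForm ℂ c₀ α β (q : ℕ)) =
      ∏ k ∈ Finset.range (h + h), intForm ℂ c₀ α β k :=
    Fin.prod_univ_eq_prod_range (fun k => intForm ℂ c₀ α β k) (h + h)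
  have hmat : (Matrix.of fun i j : Fin r => coeff
      (∑ b ∈ u i, Finsupp.single (Fin.castAdd h b) 1 + ∑ d ∈ w j, Finsupp.single (Fin.natAdd h d) 1)
      (∏ q : Fin (h + h), intForm ℂ c₀ α β (q : ℕ))) = (Int.castRingHom ℂ).mapMatrix M := by
    ext i j
    rw [Matrix.of_apply, hprod, coeff_partitionExpo_prod_intForm, RingHom.mapMatrix_apply,
      Matrix.map_apply, hM, Matrix.of_apply]
    rfl
  rw [hmat, ← RingHom.map_det]
  exact (map_ne_zero_iff _ (RingHom.injective_int _)).mpr hdetZ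

/-! ## 3. Coordinate relabelling -/

/-- The variable relabelling `x_a ↦ x_{π a}`, `y_c ↦ y_{ρ c}` as an equivalence of `Fin (h + h)`. -/
def relabelEquiv (π ρ : Equiv.Perm (Fin h)) : Fin (h + h) ≃ Fin (h + h) :=
  finSumFinEquiv.symm.trans ((Equiv.sumCongr π ρ).trans finSumFinEquiv)

/-- The relabelling on an `x`-variable. -/
theorem relabelEquiv_castAdd (π ρ : Equiv.Perm (Fin h)) (a : Fin h) :
    relabelEquiv π ρ (Fin.castAdd h a) = Fin.castAdd h (π a) := by
  simp only [relabelEquiv, Equiv.trans_apply, finSumFinEquiv_symm_apply_castAdd,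
    Equiv.sumCongr_apply, Sum.map_inl, finSumFinEquiv_apply_left]

/-- The relabelling on a `y`-variable. -/
theorem relabelEquiv_natAdd (π ρ : Equiv.Perm (Fin h)) (c : Fin h) :
    relabelEquiv π ρ (Fin.natAdd h c) = Fin.natAdd h (ρ c) := by
  simp only [relabelEquiv, Equiv.trans_apply, finSumFinEquiv_symm_apply_natAdd,
    Equiv.sumCongr_apply, Sum.map_inr, finSumFinEquiv_apply_right]

/-- The relabelling maps the partition exponent of `(u, w)` to that of `(π u, ρ w)`. -/
theorem mapDomain_relabel_partitionExpo (π ρ : Equiv.Perm (Fin h)) (u w : Finset (Fin h)) :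
    Finsupp.mapDomain (relabelEquiv π ρ)
      (∑ b ∈ u, Finsupp.single (Fin.castAdd h b) 1 + ∑ d ∈ w, Finsupp.single (Fin.natAdd h d) 1 :
        Fin (h + h) →₀ ℕ) =
      ∑ b ∈ u.map π.toEmbedding, Finsupp.single (Fin.castAdd h b) 1 +
        ∑ d ∈ w.map ρ.toEmbedding, Finsupp.single (Fin.natAdd h d) 1 := by
  rw [Finsupp.mapDomain_add, Finsupp.mapDomain_finsetSum, Finsupp.mapDomain_finsetSum,
    Finset.sum_map, Finset.sum_map]
  congr 1
  · refine Finset.sum_congr rfl fun b _ => ?_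
    rw [Finsupp.mapDomain_single, relabelEquiv_castAdd]
    rfl
  · refine Finset.sum_congr rfl fun d _ => ?_
    rw [Finsupp.mapDomain_single, relabelEquiv_natAdd]
    rfl

/-- **Coordinate relabelling for Chow witnesses**: if `(u, w)` is hit then so is
`(π u, ρ w) = (i ↦ (u i).map π, j ↦ (w j).map ρ)` for any coordinate permutations `π, ρ`. -/
theorem chow_hit_relabel {r : ℕ} (π ρ : Equiv.Perm (Fin h)) (u w : Fin r → Finset (Fin h))
    (hhit : ∃ ℓ : Fin (h + h) → MvPolynomial (Fin (h + h)) ℂ, (∀ q, (ℓ q).totalDegree ≤ 1) ∧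
      (Matrix.of fun i j : Fin r => coeff
        (∑ b ∈ u i, Finsupp.single (Fin.castAdd h b) 1 + ∑ d ∈ w j, Finsupp.single (Fin.natAdd h d) 1)
        (∏ q, ℓ q)).det ≠ 0) :
    ∃ ℓ : Fin (h + h) → MvPolynomial (Fin (h + h)) ℂ, (∀ q, (ℓ q).totalDegree ≤ 1) ∧
      (Matrix.of fun i j : Fin r => coeff
        (∑ b ∈ (u i).map π.toEmbedding, Finsupp.single (Fin.castAdd h b) 1 +
          ∑ d ∈ (w j).map ρ.toEmbedding, Finsupp.single (Fin.natAdd h d) 1)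
        (∏ q, ℓ q)).det ≠ 0 := by
  classical
  obtain ⟨ℓ, hdeg, hdet⟩ := hhit
  refine ⟨fun q => rename (relabelEquiv π ρ) (ℓ q),
    fun q => (totalDegree_rename_le _ _).trans (hdeg q), ?_⟩
  have hprod : (∏ q, rename (relabelEquiv π ρ) (ℓ q)) = rename (relabelEquiv π ρ) (∏ q, ℓ q) := by
    rw [map_prod]
  have hM : (Matrix.of fun i j : Fin r => coeff
      (∑ b ∈ (u i).map π.toEmbedding, Finsupp.single (Fin.castAdd h b) 1 +
        ∑ d ∈ (w j).map ρ.toEmbedding, Finsupp.single (Fin.natAdd h d) 1)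
      (∏ q, rename (relabelEquiv π ρ) (ℓ q))) =
      (Matrix.of fun i j : Fin r => coeff
        (∑ b ∈ u i, Finsupp.single (Fin.castAdd h b) 1 + ∑ d ∈ w j, Finsupp.single (Fin.natAdd h d) 1)
        (∏ q, ℓ q)) := by
    ext i j
    rw [Matrix.of_apply, Matrix.of_apply, hprod, ← mapDomain_relabel_partitionExpo π ρ (u i) (w j),
      coeff_rename_mapDomain _ (relabelEquiv π ρ).injective]
  rw [hM]
  exact hdet

end Summit.ValiantsHypothesis.ValiantsHypothesis.Theorems.BarrierLever.ChowFactor
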